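import Literature.NumberTheory.Sieve.ChenSieveProduct
import Literature.NumberTheory.Sieve.SmoothMajorantLocal
import HarnessLib

/-!
# From the sieve products to the Hardy–Littlewood singular series `𝔖(h)`

Topic `Literature/NumberTheory/Sieve`.  Everything in this file is PROVED (theorems only; no definition,
no named fact).  It records the elementary identity (7.3) of Matomäki–Merikoski, *Siegel zeros, twin
primes, Goldbach's conjecture, and primes in short intervals* (IMRN 2023, arXiv:2112.11412, §7):
for even `h ≠ 0`, `q ≥ 1` and `z > 2`, writing `a_p = 1 − 1/p` if `p ∣ h` and `a_p = 1 − 2/p` if `p ∤ h`,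

  `∏_{p<z, p∤q} a_p · ∏_{p∣q} a_p · ∏_{p<z} (1 − 1/p)^{−2}`
  `= 2 ∏_{2<p<z} (1 − 1/(p−1)²) ∏_{p∣h, 2<p<z} (p−1)/(p−2) · ∏_{p∣q, p≥z} a_p`

("`= 2 (1 + O(u/z)) ∏_{2<p<z} (1 − 1/(p−1)²) ∏_{p∣h, p>2} (1 + 1/(p−2))`" in the source; the three
factors on the left are, in the source, the main term of Proposition 2.3, the complete sum (8) of
Lemma 2.5, and the square of the main term of Lemma 2.4), together with the resulting comparison with
`𝔖(h) = 2C₂ ∏_{p∣h, p>2} (p−1)/(p−2)` (`goldbachSingularSeries`):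

* `prod_filter_not_dvd_mul_prod_primeFactors` — `∏_{p<z, p∤q} f · ∏_{p∣q} f = ∏_{p<z} f · ∏_{p∣q, p≥z} f`;
* `prod_localFactor_eq` — `∏_{p<z} a_p = ∏_{p<z}(1 − 1/p) · V_h(z)`, `V_h(z) = ∏_{p<z, p∤h}(1 − 1/(p−1))`
  (the tree's `Chen.sieveProduct h z`);
* `sieveProducts_eq` — the displayed identity, via the tree's `Chen.sieveProduct_eq_mul`;
* `abs_sieveProducts_sub_goldbachSingularSeries_le` — for `z ≥ 4` and `2k_h ≤ z`,
  `|LHS − 𝔖(h)| ≤ 𝔖(h) (2 + 2k_q + 4k_h)/z`, where `k_q`, `k_h` are the numbers of prime factors `≥ z`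
  of `q`, `h` (tail of `C₂`: the tree's `Chen.twinPrimeConst_le_twinPrimeConstPartial`,
  `Chen.twinPrimeConstPartial_mul_le_twinPrimeConst`; Weierstrass' inequality
  `CFZ.one_sub_sum_le_prod_one_sub`).  In the source `k_q, k_h ≤ log(qh)/log z ≪ u`, giving its
  `1 + O(u/z)`.

## References

* K. Matomäki, J. Merikoski, IMRN 2023 (arXiv:2112.11412), §7, display (7.3).
  [cite: MatomakiMerikoski2023, §7 (7.3)]
* M. B. Nathanson, *Additive Number Theory: The Classical Bases*, GTM 164, Thm 10.3 (proof: the same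
  manipulation of `V(z)`). [Nathanson1996]
-/

noncomputable section

open Finset Real

namespace Literature.NumberTheory.Sieve

namespace SieveProductsSingularSeries

open Chen (sieveProduct sieveProduct_eq_mul singularSeries goldbachSingularSeries_eq_two_mul_singularSeries
  twinPrimeConst_le_twinPrimeConstPartial twinPrimeConstPartial_mul_le_twinPrimeConst)

/-! ### Regrouping the products -/

/-- `∏_{p<z, p∤q} f(p) · ∏_{p∣q} f(p) = ∏_{p<z} f(p) · ∏_{p∣q, p≥z} f(p)` (`q ≠ 0`; products over
primes). [folklore] -/
theorem prod_filter_not_dvd_mul_prod_primeFactors {q : ℕ} (hq : q ≠ 0) (z : ℝ) (f : ℕ → ℝ) :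
    (∏ p ∈ (Nat.primesBelow ⌈z⌉₊).filter (fun p => ¬ p ∣ q), f p) * (∏ p ∈ q.primeFactors, f p) =
      (∏ p ∈ Nat.primesBelow ⌈z⌉₊, f p) * ∏ p ∈ q.primeFactors.filter (fun p : ℕ => z ≤ (p : ℝ)), f p := by
  have hsplit : ∏ p ∈ q.primeFactors, f p =
      (∏ p ∈ q.primeFactors.filter (fun p : ℕ => (p : ℝ) < z), f p) *
        ∏ p ∈ q.primeFactors.filter (fun p : ℕ => z ≤ (p : ℝ)), f p := by
    rw [← Finset.prod_filter_mul_prod_filter_not q.primeFactors (fun p : ℕ => (p : ℝ) < z)]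
    simp only [not_lt]
  have hset : q.primeFactors.filter (fun p : ℕ => (p : ℝ) < z) = (Nat.primesBelow ⌈z⌉₊).filter (· ∣ q) := by
    ext p
    simp only [Finset.mem_filter, Nat.mem_primeFactors, Nat.mem_primesBelow, Nat.lt_ceil]
    constructor
    · rintro ⟨⟨hp, hpq, -⟩, hpz⟩; exact ⟨⟨hpz, hp⟩, hpq⟩
    · rintro ⟨⟨hpz, hp⟩, hpq⟩; exact ⟨⟨hp, hpq, hq⟩, hpz⟩
  rw [hsplit, hset, ← mul_assoc, mul_comm (∏ p ∈ (Nat.primesBelow ⌈z⌉₊).filter (fun p => ¬ p ∣ q), f p),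
    Finset.prod_filter_mul_prod_filter_not]

/-- `∏_{p<z} a_p = ∏_{p<z} (1 − 1/p) · ∏_{p<z, p∤h} (1 − 1/(p−1))` with `a_p = 1 − 1/p` (`p ∣ h`),
`1 − 2/p` (`p ∤ h`): pointwise `(1 − 1/p)(1 − 1/(p−1)) = 1 − 2/p`. The second factor is the tree's
`Chen.sieveProduct h z`. [cite: MatomakiMerikoski2023, §7 (7.3)] -/
theorem prod_localFactor_eq (h : ℕ) (z : ℝ) :
    ∏ p ∈ Nat.primesBelow ⌈z⌉₊, (if p ∣ h then 1 - 1 / (p : ℝ) else 1 - 2 / (p : ℝ)) =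
      (∏ p ∈ Nat.primesBelow ⌈z⌉₊, (1 - (p : ℝ)⁻¹)) * sieveProduct h z := by
  unfold sieveProduct
  rw [Finset.prod_filter, ← Finset.prod_mul_distrib]
  refine Finset.prod_congr rfl fun p hp => ?_
  have hp2 : (2 : ℝ) ≤ p := by exact_mod_cast (Nat.prime_of_mem_primesBelow hp).two_le
  have hp0 : (p : ℝ) ≠ 0 := by positivity
  have hp1 : (p : ℝ) - 1 ≠ 0 := by linarith
  split_ifs with hph
  · simp
  · field_simp
    ring

/-- **Matomäki–Merikoski (7.3), exact form.** For even `h ≠ 0`, `q ≠ 0` and `z > 2`: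
`∏_{p<z, p∤q} a_p · ∏_{p∣q} a_p · (∏_{p<z} (1 − 1/p))^{−2}`
`= 2 ∏_{2<p≤⌈z⌉−1} (1 − 1/(p−1)²) · ∏_{p∣h, 2<p<z} (p−1)/(p−2) · ∏_{p∣q, p≥z} a_p`.
[cite: MatomakiMerikoski2023, §7 (7.3)] -/
theorem sieveProducts_eq {h q : ℕ} (hh : Even h) (hh0 : h ≠ 0) (hq : q ≠ 0) {z : ℝ} (hz : 2 < z) :
    (∏ p ∈ (Nat.primesBelow ⌈z⌉₊).filter (fun p => ¬ p ∣ q),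
        (if p ∣ h then 1 - 1 / (p : ℝ) else 1 - 2 / (p : ℝ))) *
      (∏ p ∈ q.primeFactors, (if p ∣ h then 1 - 1 / (p : ℝ) else 1 - 2 / (p : ℝ))) *
      ((∏ p ∈ Nat.primesBelow ⌈z⌉₊, (1 - (p : ℝ)⁻¹))⁻¹) ^ 2 =
    2 * twinPrimeConstPartial (⌈z⌉₊ - 1) *
      (∏ p ∈ (h.primeFactors.filter (2 < ·)).filter (· < ⌈z⌉₊), (((p : ℝ) - 1) / ((p : ℝ) - 2))) *
      ∏ p ∈ q.primeFactors.filter (fun p : ℕ => z ≤ (p : ℝ)),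
        (if p ∣ h then 1 - 1 / (p : ℝ) else 1 - 2 / (p : ℝ)) := by
  set U : ℝ := ∏ p ∈ Nat.primesBelow ⌈z⌉₊, (1 - (p : ℝ)⁻¹) with hU
  have hU0 : U ≠ 0 := by
    rw [hU]
    refine Finset.prod_ne_zero_iff.mpr fun p hp => ?_
    have hp2 : (2 : ℝ) ≤ p := by exact_mod_cast (Nat.prime_of_mem_primesBelow hp).two_le
    have : (p : ℝ)⁻¹ ≤ 1 / 2 := by rw [inv_le_comm₀ (by linarith) (by norm_num)]; linarith
    linarith
  have hT : ∏ p ∈ (Nat.primesBelow ⌈z⌉₊).filter (2 < ·), (1 - 1 / ((p : ℝ) - 1) ^ 2) =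
      twinPrimeConstPartial (⌈z⌉₊ - 1) := by
    rw [twinPrimeConstPartial, Nat.primesBelow_eq_primesLE_sub_one]
  rw [prod_filter_not_dvd_mul_prod_primeFactors hq, prod_localFactor_eq, sieveProduct_eq_mul hh hh0 hz,
    ← hU, hT]
  field_simp

/-! ### Comparison with `𝔖(h)` -/

/-- `e^s − 1 ≤ 2s` for `0 ≤ s ≤ 1` (local copy of `SquarefreeSums.exp_sub_one_le_two_mul`, kept
`private` to avoid the import of `CoprimeSquarefreeSumsBounds`). [folklore] -/
private theorem exp_sub_one_le_two_mul {s : ℝ} (hs0 : 0 ≤ s) (hs1 : s ≤ 1) : Real.exp s - 1 ≤ 2 * s := by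
  have := Real.abs_exp_sub_one_le (x := s) (by rw [abs_of_nonneg hs0]; exact hs1)
  rw [abs_of_nonneg hs0] at this
  exact (le_abs_self _).trans this

/-- **(7.3) compared with the singular series.**  For even `h ≠ 0`, `q ≠ 0`, `z ≥ 4`, with
`k_q = #{p ∣ q : p ≥ z}`, `k_h = #{p ∣ h : p ≥ z}` and `2k_h ≤ z`:
`|∏_{p<z, p∤q} a_p · ∏_{p∣q} a_p · (∏_{p<z}(1 − 1/p))^{−2} − 𝔖(h)| ≤ 𝔖(h) (2 + 2k_q + 4k_h)/z`
(`C₂ ≤ ∏_{2<p<z}(1 − 1/(p−1)²) ≤ C₂(1 + 2/z)`, `1 − 2k_q/z ≤ ∏_{p∣q, p≥z} a_p ≤ 1`,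
`1 ≤ ∏_{p∣h, p≥z}(p−1)/(p−2) ≤ e^{2k_h/z} ≤ 1 + 4k_h/z`); the source's "`(1 + O(u/z))`", as there
`k_q, k_h ≤ log(qh)/log z ≪ u`. [cite: MatomakiMerikoski2023, §7 (7.3)] -/
theorem abs_sieveProducts_sub_goldbachSingularSeries_le {h q : ℕ} (hh : Even h) (hh0 : h ≠ 0)
    (hq : q ≠ 0) {z : ℝ} (hz : 4 ≤ z)
    (hkh : 2 * (#(h.primeFactors.filter (fun p : ℕ => z ≤ (p : ℝ))) : ℝ) ≤ z) :
    |(∏ p ∈ (Nat.primesBelow ⌈z⌉₊).filter (fun p => ¬ p ∣ q),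
          (if p ∣ h then 1 - 1 / (p : ℝ) else 1 - 2 / (p : ℝ))) *
        (∏ p ∈ q.primeFactors, (if p ∣ h then 1 - 1 / (p : ℝ) else 1 - 2 / (p : ℝ))) *
        ((∏ p ∈ Nat.primesBelow ⌈z⌉₊, (1 - (p : ℝ)⁻¹))⁻¹) ^ 2 - goldbachSingularSeries h| ≤
      goldbachSingularSeries h *
        ((2 + 2 * #(q.primeFactors.filter (fun p : ℕ => z ≤ (p : ℝ))) +
          4 * #(h.primeFactors.filter (fun p : ℕ => z ≤ (p : ℝ)))) / z) := by
  have hz0 : 0 < z := by linarith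
  have hz2 : 2 < z := by linarith
  rw [sieveProducts_eq hh hh0 hq hz2, goldbachSingularSeries_eq_two_mul_singularSeries hh]
  unfold Chen.singularSeries
  -- names
  set kq : ℕ := #(q.primeFactors.filter (fun p : ℕ => z ≤ (p : ℝ))) with hkq
  set kh : ℕ := #(h.primeFactors.filter (fun p : ℕ => z ≤ (p : ℝ))) with hkh_def
  set T : ℝ := twinPrimeConstPartial (⌈z⌉₊ - 1) with hT
  set C₂ : ℝ := twinPrimeConst with hC₂
  set ρ : ℝ := ∏ p ∈ q.primeFactors.filter (fun p : ℕ => z ≤ (p : ℝ)),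
    (if p ∣ h then 1 - 1 / (p : ℝ) else 1 - 2 / (p : ℝ)) with hρ
  set Dl : ℝ := ∏ p ∈ (h.primeFactors.filter (2 < ·)).filter (· < ⌈z⌉₊), (((p : ℝ) - 1) / ((p : ℝ) - 2))
    with hDl
  set Dg : ℝ := ∏ p ∈ (h.primeFactors.filter (2 < ·)).filter (fun p => ¬ p < ⌈z⌉₊),
    (((p : ℝ) - 1) / ((p : ℝ) - 2)) with hDg
  have hD : ∏ p ∈ h.primeFactors.filter (2 < ·), (((p : ℝ) - 1) / ((p : ℝ) - 2)) = Dl * Dg :=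
    (Finset.prod_filter_mul_prod_filter_not _ _ _).symm
  rw [hD]
  -- the local factors `(p-1)/(p-2) ≥ 1` (`p > 2`)
  have hfac : ∀ p ∈ h.primeFactors.filter (2 < ·), 1 ≤ ((p : ℝ) - 1) / ((p : ℝ) - 2) := by
    intro p hp
    have h3 : (3 : ℝ) ≤ p := by exact_mod_cast (Finset.mem_filter.mp hp).2
    rw [le_div_iff₀ (by linarith)]; linarith
  have hDl1 : 1 ≤ Dl := by
    rw [hDl]
    calc (1 : ℝ) = ∏ p ∈ (h.primeFactors.filter (2 < ·)).filter (· < ⌈z⌉₊), (1 : ℝ) := by simp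
      _ ≤ _ := Finset.prod_le_prod (fun _ _ => zero_le_one)
          fun p hp => hfac p (Finset.mem_filter.mp hp).1
  have hDg1 : 1 ≤ Dg := by
    rw [hDg]
    calc (1 : ℝ) = ∏ p ∈ (h.primeFactors.filter (2 < ·)).filter (fun p => ¬ p < ⌈z⌉₊), (1 : ℝ) := by simp
      _ ≤ _ := Finset.prod_le_prod (fun _ _ => zero_le_one)
          fun p hp => hfac p (Finset.mem_filter.mp hp).1
  have hDl0 : 0 ≤ Dl := by linarith
  -- `Dg ≤ e^{2 k_h/z} ≤ 1 + 4 k_h/z`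
  have hzc : z ≤ ⌈z⌉₊ := Nat.le_ceil z
  have hDg_le : Dg ≤ 1 + 4 * kh / z := by
    have hcard : #((h.primeFactors.filter (2 < ·)).filter (fun p => ¬ p < ⌈z⌉₊)) ≤ kh := by
      rw [hkh_def]
      refine Finset.card_le_card fun p hp => ?_
      simp only [Finset.mem_filter, not_lt] at hp ⊢
      exact ⟨hp.1.1, hzc.trans (by exact_mod_cast hp.2)⟩
    have h1 : Dg ≤ (1 + 2 / z) ^ #((h.primeFactors.filter (2 < ·)).filter (fun p => ¬ p < ⌈z⌉₊)) := by
      rw [hDg, ← Finset.prod_const]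
      refine Finset.prod_le_prod (fun p hp => ?_) (fun p hp => ?_)
      · exact zero_le_one.trans (hfac p (Finset.mem_filter.mp hp).1)
      · simp only [Finset.mem_filter, not_lt] at hp
        have hpz : z ≤ p := hzc.trans (by exact_mod_cast hp.2)
        have hp4 : (4 : ℝ) ≤ p := hz.trans hpz
        have hp2 : (p : ℝ) - 2 ≠ 0 := by linarith
        have e : ((p : ℝ) - 1) / ((p : ℝ) - 2) = 1 + 1 / ((p : ℝ) - 2) := by
          field_simp; ring
        rw [e, add_le_add_iff_left, div_le_div_iff₀ (by linarith) hz0]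
        linarith
    have h12z : (1 : ℝ) ≤ 1 + 2 / z := by
      have : 0 ≤ 2 / z := by positivity
      linarith
    have h2 : (1 + 2 / z) ^ #((h.primeFactors.filter (2 < ·)).filter (fun p => ¬ p < ⌈z⌉₊)) ≤
        (1 + 2 / z) ^ kh := pow_le_pow_right₀ h12z hcard
    have h3 : (1 + 2 / z) ^ kh ≤ Real.exp (2 / z) ^ kh :=
      pow_le_pow_left₀ (by positivity) (by linarith [Real.add_one_le_exp (2 / z)]) kh
    have h4 : Real.exp (2 / z) ^ kh = Real.exp (2 * kh / z) := by
      rw [← Real.exp_nat_mul]; congr 1; ring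
    have h5 : Real.exp (2 * kh / z) ≤ 1 + 2 * (2 * kh / z) := by
      have hs0 : 0 ≤ 2 * (kh : ℝ) / z := by positivity
      have hs1 : 2 * (kh : ℝ) / z ≤ 1 := by rw [div_le_one hz0]; exact hkh
      linarith [exp_sub_one_le_two_mul hs0 hs1]
    calc Dg ≤ _ := h1
      _ ≤ _ := h2
      _ ≤ _ := h3
      _ = _ := h4
      _ ≤ 1 + 2 * (2 * kh / z) := h5
      _ = 1 + 4 * kh / z := by ring
  -- `1 − 2 k_q/z ≤ ρ ≤ 1`
  have hρ_eq : ρ = ∏ p ∈ q.primeFactors.filter (fun p : ℕ => z ≤ (p : ℝ)),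
      (1 - (if p ∣ h then 1 / (p : ℝ) else 2 / (p : ℝ))) := by
    rw [hρ]
    refine Finset.prod_congr rfl fun p _ => ?_
    split_ifs <;> ring
  have hε : ∀ p ∈ q.primeFactors.filter (fun p : ℕ => z ≤ (p : ℝ)),
      0 ≤ (if p ∣ h then 1 / (p : ℝ) else 2 / (p : ℝ)) ∧
        (if p ∣ h then 1 / (p : ℝ) else 2 / (p : ℝ)) ≤ 2 / z := by
    intro p hp
    have hpz : z ≤ p := (Finset.mem_filter.mp hp).2
    have hp0 : (0 : ℝ) < p := by linarith
    have h2 : 2 / (p : ℝ) ≤ 2 / z := div_le_div_of_nonneg_left (by norm_num) hz0 hpz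
    have h1 : 1 / (p : ℝ) ≤ 2 / p := div_le_div_of_nonneg_right (by norm_num) hp0.le
    split_ifs
    · exact ⟨by positivity, h1.trans h2⟩
    · exact ⟨by positivity, h2⟩
  have h2z1 : 2 / z ≤ 1 := by rw [div_le_one hz0]; linarith
  have hρ1 : ρ ≤ 1 := by
    rw [hρ_eq]
    refine Finset.prod_le_one (fun p hp => ?_) (fun p hp => ?_)
    · linarith [(hε p hp).2]
    · linarith [(hε p hp).1]
  have hρ0 : 0 ≤ ρ := by
    rw [hρ_eq]
    exact Finset.prod_nonneg fun p hp => by linarith [(hε p hp).2]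
  have hρlow : 1 - 2 * kq / z ≤ ρ := by
    rw [hρ_eq]
    have hW := Literature.NumberTheory.Sieve.CFZ.one_sub_sum_le_prod_one_sub
      (q.primeFactors.filter (fun p : ℕ => z ≤ (p : ℝ)))
      (ε := fun p => if p ∣ h then 1 / (p : ℝ) else 2 / (p : ℝ))
      (fun p hp => (hε p hp).1) (fun p hp => ((hε p hp).2.trans h2z1))
    have hsum : ∑ p ∈ q.primeFactors.filter (fun p : ℕ => z ≤ (p : ℝ)),
        (if p ∣ h then 1 / (p : ℝ) else 2 / (p : ℝ)) ≤ kq * (2 / z) := by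
      have := Finset.sum_le_card_nsmul _ _ (2 / z) (fun p hp => (hε p hp).2)
      rwa [nsmul_eq_mul, ← hkq] at this
    calc 1 - 2 * kq / z = 1 - kq * (2 / z) := by ring
      _ ≤ 1 - ∑ p ∈ q.primeFactors.filter (fun p : ℕ => z ≤ (p : ℝ)),
          (if p ∣ h then 1 / (p : ℝ) else 2 / (p : ℝ)) := by linarith
      _ ≤ _ := hW
  -- `C₂ ≤ T ≤ C₂ (1 + 2/z)`
  have hC₂0 : 0 < C₂ := twinPrimeConst_pos_holds
  have hTlow : C₂ ≤ T := twinPrimeConst_le_twinPrimeConstPartial _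
  have hT0 : 0 ≤ T := hC₂0.le.trans hTlow
  have hTup : T ≤ C₂ * (1 + 2 / z) := by
    set x : ℕ := ⌈z⌉₊ - 1 with hx
    have hn4 : 4 ≤ ⌈z⌉₊ := Nat.lt_ceil.mpr (by push_cast; linarith)
    have hx3 : 3 ≤ x := by omega
    have hxR : (x : ℝ) = ⌈z⌉₊ - 1 := by
      rw [hx, Nat.cast_sub (by omega)]; simp
    have hx1z : z / 2 ≤ (x : ℝ) - 1 := by rw [hxR]; linarith
    have hx0 : (0 : ℝ) < x := by exact_mod_cast (show 0 < x by omega)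
    have hx1 : (0 : ℝ) < (x : ℝ) - 1 := by linarith
    have hmul := twinPrimeConstPartial_mul_le_twinPrimeConst (x := x) (by omega)
    rw [← hT] at hmul
    -- `T = T ((x-1)/x) (x/(x-1)) ≤ C₂ x/(x-1) ≤ C₂ (1 + 2/z)`
    have h1 : T = T * (((x : ℝ) - 1) / x) * ((x : ℝ) / ((x : ℝ) - 1)) := by
      field_simp
    have h2 : (x : ℝ) / ((x : ℝ) - 1) ≤ 1 + 2 / z := by
      rw [div_le_iff₀ hx1]
      have : (x : ℝ) = ((x : ℝ) - 1) + 1 := by ring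
      have h3 : (1 : ℝ) ≤ 2 / z * ((x : ℝ) - 1) := by
        rw [div_mul_eq_mul_div, le_div_iff₀ hz0]; linarith
      nlinarith only [this, h3, hx1]
    calc T = T * (((x : ℝ) - 1) / x) * ((x : ℝ) / ((x : ℝ) - 1)) := h1
      _ ≤ C₂ * ((x : ℝ) / ((x : ℝ) - 1)) := mul_le_mul_of_nonneg_right hmul (by positivity)
      _ ≤ C₂ * (1 + 2 / z) := mul_le_mul_of_nonneg_left h2 hC₂0.le
  -- the comparison
  have hkq0 : (0 : ℝ) ≤ kq := Nat.cast_nonneg _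
  have hkh0 : (0 : ℝ) ≤ kh := Nat.cast_nonneg _
  have hup : ρ * T - C₂ * Dg ≤ C₂ * (2 / z) := by
    have h1 : ρ * T ≤ T := by nlinarith only [hρ1, hT0, hρ0]
    have h2 : C₂ ≤ C₂ * Dg := le_mul_of_one_le_right hC₂0.le hDg1
    nlinarith only [h1, h2, hTup]
  have hlow : C₂ * Dg - ρ * T ≤ C₂ * ((2 * kq + 4 * kh) / z) := by
    have h1 : ρ * C₂ ≤ ρ * T := mul_le_mul_of_nonneg_left hTlow hρ0
    have h2 : (1 - 2 * kq / z) * C₂ ≤ ρ * C₂ := mul_le_mul_of_nonneg_right hρlow hC₂0.le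
    have h3 : C₂ * Dg ≤ C₂ * (1 + 4 * kh / z) := mul_le_mul_of_nonneg_left hDg_le hC₂0.le
    have e : C₂ * (1 + 4 * kh / z) - (1 - 2 * kq / z) * C₂ = C₂ * ((2 * kq + 4 * kh) / z) := by ring
    linarith only [h1, h2, h3, e]
  have habs : |ρ * T - C₂ * Dg| ≤ C₂ * ((2 + 2 * kq + 4 * kh) / z) := by
    have hA : 0 ≤ C₂ * (2 / z) := by positivity
    have hB : 0 ≤ C₂ * ((2 * kq + 4 * kh) / z) := by positivity
    have e : C₂ * ((2 + 2 * kq + 4 * kh) / z) = C₂ * (2 / z) + C₂ * ((2 * kq + 4 * kh) / z) := by ring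
    rw [abs_le, e]
    constructor <;> linarith only [hup, hlow, hA, hB]
  have e1 : 2 * T * Dl * ρ - 2 * (C₂ * (Dl * Dg)) = 2 * Dl * (ρ * T - C₂ * Dg) := by ring
  rw [e1, abs_mul, abs_of_nonneg (by positivity : (0 : ℝ) ≤ 2 * Dl)]
  have hfrac0 : 0 ≤ (2 + 2 * (kq : ℝ) + 4 * kh) / z := by positivity
  calc 2 * Dl * |ρ * T - C₂ * Dg| ≤ 2 * Dl * (C₂ * ((2 + 2 * kq + 4 * kh) / z)) :=
        mul_le_mul_of_nonneg_left habs (by positivity)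
    _ = 2 * (C₂ * (Dl * 1)) * ((2 + 2 * kq + 4 * kh) / z) := by ring
    _ ≤ 2 * (C₂ * (Dl * Dg)) * ((2 + 2 * kq + 4 * kh) / z) := by
        have h1 : Dl * 1 ≤ Dl * Dg := mul_le_mul_of_nonneg_left hDg1 hDl0
        have h2 : C₂ * (Dl * 1) ≤ C₂ * (Dl * Dg) := mul_le_mul_of_nonneg_left h1 hC₂0.le
        have h3 : 2 * (C₂ * (Dl * 1)) ≤ 2 * (C₂ * (Dl * Dg)) := by linarith
        exact mul_le_mul_of_nonneg_right h3 hfrac0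

end SieveProductsSingularSeries

end Literature.NumberTheory.Sieve
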